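import Summits.ValiantsHypothesis.ValiantsHypothesis.Theorems.LacunarySymmetroidMatrixDescartesCensusAtomM4K4CF30
import Summits.ValiantsHypothesis.ValiantsHypothesis.Theorems.LacunarySymmetroidMatrixDescartesCensusAtomM4K5EB37
import Summits.ValiantsHypothesis.ValiantsHypothesis.Theorems.LacunarySymmetroidMatrixDescartesCensusAtomM4K5EB38
import Summits.ValiantsHypothesis.ValiantsHypothesis.Theorems.LacunarySymmetroidMatrixDescartesCensusAtomM4K6KC45

/-!
# `MatrixDescartes` census — THE `m = 4` ROW LAW: `ζ_sym(4,K) > P(4,K) = 10K − 16` for EVERY `K ≥ 4`, by a periodic block ladder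

HONEST FRAMING.  Experiment cell `val-V1-extremal`, width seat val-v1x-eng-9 g3 (`--supports stmt-ValiantsHypothesis-18050 --as helper`).
LOWER-bound / construction mathematics in census (CONJECTURE-A) currency: explicit real symmetric lacunary `4 × 4` pencils with many distinct
positive determinant roots, for every number of letters `K`.  It proves NOTHING about the crux `Theses.LacunarySymmetroid.MatrixDescartes`
(stmt-ValiantsHypothesis-18050 — an UPPER bound at fat formats; a fixed-`m` row is polynomial in `K`), nothing about `DoorA26` / `DoorA34`,
nothing about `VP ≠ VNP`; VP ≠ VNP is NOT proved.  No definitions, no `sorry`.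

THE LAW.  `P(4,K) = 10K − 16` (parameter count).  For EVERY `K ≥ 4`:

  **`rowLaw : ¬ PosRootLawAt 4 K (10·K − 16)`**, i.e. `ζ_sym(4,K) ≥ P(4,K) + 1`,

with the periodic excess `+6 / +3 / +1` over `P` along `K ≡ 1 / 2 / 0 (mod 3)` (`row_one`, `row_two`, `row_zero`) — `K`-slope EXACTLY the
`P`-slope `10` (the cell's all-`(m,K)` law `VSQ.gen_law` reads `10K − 19 = P − 3` here; the `P4` chain ladder `8` per letter).  Companion of
`…CensusRowLawM5` (`m = 5`: slope `61/4 > 15`, unbounded excess).  No located `m = 4` atom exceeds the `P`-slope threshold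
`T(4,K_F) = 10(K_F − 1)` (val-v1x-eng-7 g3 GROWTH-v2: `CAPF30 = 30 = T(4,4)` sits exactly on it), so bounded excess is all this mechanism gives at `m = 4`.

MECHANISM (bookkeeping over kernel-certified blocks of val-v1x-eng-8 g3's atom bank; `Chain.chain_append` = the tree's junction law for matching
junction inertia, seat val-sym-mdr-p1).  Period = val-v1x-eng-1's `CAPF30` (`(4,4) = 30`, block `AtomM4K4CF30`, end inertias `(3,1)/(3,1)` — self-matching,
so `C ▹ C ▹ …` needs no negation): `q + 1` periods = `3q + 4` letters, `30(q+1)` alternations (`chain`).  Terminal pieces on the free `(3,1)` end: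
eng-2's `ENDBOTH37` reversed and negated (`block_reverse AtomM4K5EB37.blockNeg`: bottom `(3,1)`, `+4` letters, `+37`) for `K ≡ 2 (mod 3)`, and
val-v1x-eng-9 g2's `KCAP45` negated (`AtomM4K6KC45.blockNeg`: bottom `(3,1)`, `+5` letters, `+45`) for `K ≡ 0 (mod 3)`; the small cells `K = 5, 6` are
eng-2's `ENDBOTH38` and `KCAP45` read as rows (inline).  Per residue: `K = 3q+4: 30(q+1) = P + 6`; `3q+8: 30(q+1) + 37 = P + 3`; `3q+9: 30(q+1) + 45 = P + 1`.
The finite cells `K ≤ 13` of this ladder are ALREADY val-v1x-eng-8 g3's block words (`MixM4.mix_4_11 = 97`, `mix_4_12 = 105`, `mix_4_13 = 120`); new here is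
the all-`K` statement (and `(4,14) ≥ 127`, `(4,15) ≥ 135`, `(4,16) ≥ 150` as samples).
Credits: rows val-v1x-eng-1 (CAPF30), val-v1x-eng-2 g2 (ENDBOTH37/38), val-v1x-eng-9 g2 (KCAP45); block kit + atom bank val-v1x-eng-8 g3; junction calculus
val-sym-mdr-p1.  [folklore] throughout (Sylvester's law of inertia, intermediate value theorem — inside the cited tree lemmas).
-/

-- `Summit.ValiantsHypothesis.ValiantsHypothesis.…` repeats a component by the D-0017 layout
-- (single-conjunct summit), which the `dupNamespace` linter flags; the name is mandated.
set_option linter.dupNamespace false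

namespace Summit.ValiantsHypothesis.ValiantsHypothesis.Theorems.LacunarySymmetroidMatrixDescartes.Census.Reflect.RowLawM4

open Summit.ValiantsHypothesis.ValiantsHypothesis.Theorems.MatrixDescartes.Negative (PosRootLawAt)
open Summit.ValiantsHypothesis.ValiantsHypothesis.Theorems.LacunarySymmetroidMatrixDescartes.Census
open Summit.ValiantsHypothesis.ValiantsHypothesis.Theorems.LacunarySymmetroidMatrixDescartes.Census.Reflect
open scoped BigOperators Matrix

/-- Rows are monotone in the bound (contrapositive form). [folklore] -/
theorem mono {m K B B' : ℕ} (h : ¬ PosRootLawAt m K B') (hB : B ≤ B') : ¬ PosRootLawAt m K B :=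
  fun h' => h (fun d S hS => (h' d S hS).trans hB)

/-! ### The periodic ladder `C ▹ C ▹ …` (`C = AtomM4K4CF30`) -/

/-- **Ladder**: `q + 1` copies of `CAPF30` — a chain with `3q + 4` letters, `30(q+1)` alternations and top Sylvester form of inertia `(3,1)`.
[folklore] -/
theorem chain (q : ℕ) : ∃ (d : Fin (3 * q + 3 + 1) → ℕ) (S : Fin (3 * q + 3 + 1) → Matrix (Fin 4) (Fin 4) ℝ)
      (τ : Fin (30 * q + 30 + 1) → ℝ),
    StrictMono d ∧ (∀ h1 : 0 < 3 * q + 3 + 1, ∃ C : Matrix (Fin 4) (Fin 4) ℝ, C.det ≠ 0 ∧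
      Cᵀ * S ⟨3 * q + 3 + 1 - 1, Nat.sub_lt h1 one_pos⟩ * C
        = Matrix.diagonal (![(1 : ℝ), (1 : ℝ), (1 : ℝ), (-1 : ℝ)] : Fin 4 → ℝ)) ∧
    (∀ l, (S l).IsSymm) ∧ StrictMono τ ∧ (∀ j, 0 < τ j) ∧ (∀ j, (∑ l, τ j ^ d l • S l).det ≠ 0) ∧
    ∀ j : Fin (30 * q + 30), (∑ l, τ j.castSucc ^ d l • S l).det * (∑ l, τ j.succ ^ d l • S l).det < 0 := by
  induction q with
  | zero =>
    exact Chain.certificateT_transport (by norm_num) (by norm_num) (Chain.chain_of_block AtomM4K4CF30.block)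
  | succ q ih =>
    have h1 := Chain.chain_append (K₁ := 3 * q + 3) (K₂ := 3) (by norm_num) ih AtomM4K4CF30.block
      (Equiv.refl (Fin 4)) (by intro i; fin_cases i <;> norm_num)
    exact Chain.certificateT_transport (by ring) (by ring) h1

/-! ### Rows by residue of `K (mod 3)` -/

/-- **`K ≡ 1 (mod 3)`: `ζ_sym(4, 3q+4) ≥ 30(q+1) = P + 6`** (`q = 0` is `CAPF30`, `q = 1` the kernel's `(4,7) ≥ 60`, `q = 3` reads `(4,13) ≥ 120`).
[folklore] -/
theorem row_one (q : ℕ) : ¬ PosRootLawAt 4 (3 * q + 4) (30 * q + 29) := by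
  have h := Chain.not_posRootLawAt_of_certificateT (by omega) (chain q)
  rw [show 3 * q + 4 = 3 * q + 3 + 1 by ring, show 30 * q + 29 = 30 * q + 30 - 1 by omega]
  exact h

/-- **`K ≡ 2 (mod 3)`, `K ≥ 8`: `ζ_sym(4, 3q+8) ≥ 30(q+1) + 37 = P + 3`** (terminal block = `ENDBOTH37` reversed and negated, bottom inertia `(3,1)`).
[folklore] -/
theorem row_two (q : ℕ) : ¬ PosRootLawAt 4 (3 * q + 8) (30 * q + 66) := by
  have h := Chain.not_posRootLawAt_of_certificateT (by omega)
    (Chain.chain_append (K₁ := 3 * q + 3) (K₂ := 4) (by norm_num) (chain q) (block_reverse AtomM4K5EB37.blockNeg)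
      (Equiv.refl (Fin 4)) (by intro i; fin_cases i <;> norm_num))
  rw [show 3 * q + 8 = 3 * q + 3 + 4 + 1 by ring, show 30 * q + 66 = 30 * q + 30 + 37 - 1 by omega]
  exact h

/-- **`K ≡ 0 (mod 3)`, `K ≥ 9`: `ζ_sym(4, 3q+9) ≥ 30(q+1) + 45 = P + 1`** (terminal block = `KCAP45` negated, bottom inertia `(3,1)`). [folklore] -/
theorem row_zero (q : ℕ) : ¬ PosRootLawAt 4 (3 * q + 9) (30 * q + 74) := by
  have h := Chain.not_posRootLawAt_of_certificateT (by omega)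
    (Chain.chain_append (K₁ := 3 * q + 3) (K₂ := 5) (by norm_num) (chain q) AtomM4K6KC45.blockNeg
      (Equiv.refl (Fin 4)) (by intro i; fin_cases i <;> norm_num))
  rw [show 3 * q + 9 = 3 * q + 3 + 5 + 1 by ring, show 30 * q + 74 = 30 * q + 30 + 45 - 1 by omega]
  exact h

/-! ### The law -/

/-- **THE `m = 4` ROW LAW.**  For every `K ≥ 4` some real symmetric `K`-letter `4 × 4` lacunary pencil has at least
`P(4,K) + 1 = 10K − 15` distinct positive determinant roots: `¬ PosRootLawAt 4 K (10K − 16)`.  A LOWER bound in census currency for one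
row of the table; nothing about the crux `MatrixDescartes`. [folklore] -/
theorem rowLaw (K : ℕ) (hK : 4 ≤ K) : ¬ PosRootLawAt 4 K (10 * K - 16) := by
  rcases Nat.lt_or_ge K 7 with h7 | h7
  · interval_cases K
    · exact mono (row_one 0) (by norm_num)
    · -- `K = 5`: eng-2's `ENDBOTH38` block read as a row (`ζ_sym(4,5) ≥ 38 = P + 4`; the tree's `endboth38_not_posRootLawAt_4_5_37`)
      exact mono (Chain.not_posRootLawAt_of_block (by norm_num) AtomM4K5EB38.block) (by norm_num)
    · -- `K = 6`: val-v1x-eng-9 g2's `KCAP45` block read as a row (`ζ_sym(4,6) ≥ 45 = P + 1`; the cell's value is `46`, `…CensusM4K6KC46`)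
      exact mono (Chain.not_posRootLawAt_of_block (by norm_num) AtomM4K6KC45.block) (by norm_num)
  · obtain ⟨q, r, hr, rfl⟩ : ∃ q r, r < 3 ∧ K = 3 * q + 7 + r :=
      ⟨(K - 7) / 3, (K - 7) % 3, Nat.mod_lt _ (by norm_num), by omega⟩
    rcases hr_cases : r with _ | _ | _ | r'
    · have h := row_one (q + 1)
      rw [show 3 * (q + 1) + 4 = 3 * q + 7 + 0 by ring] at h
      exact mono h (by omega)
    · exact mono (row_two q) (by omega)
    · exact mono (row_zero q) (by omega)
    · omega

/-! ### Numeral cells beyond the kernel's table (census format `(m,K) ≥ B + 1` reads `¬ PosRootLawAt m K B`; the cells `K ≤ 13` of this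
ladder are already val-v1x-eng-8 g3's block words `MixM4.mix_4_11 / mix_4_12 / mix_4_13`) -/

/-- `ζ_sym(4,14) ≥ 127`. [folklore] -/
theorem row_4_14 : ¬ PosRootLawAt 4 14 126 := row_two 2

/-- `ζ_sym(4,15) ≥ 135`. [folklore] -/
theorem row_4_15 : ¬ PosRootLawAt 4 15 134 := row_zero 2

/-- `ζ_sym(4,16) ≥ 150`. [folklore] -/
theorem row_4_16 : ¬ PosRootLawAt 4 16 149 := row_one 4

end Summit.ValiantsHypothesis.ValiantsHypothesis.Theorems.LacunarySymmetroidMatrixDescartes.Census.Reflect.RowLawM4
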